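/-
Copyright (c) 2026. All rights reserved.
Released under Apache 2.0 license as described in the file LICENSE.
-/
import Literature.NumberTheory.Automorphic.DefiniteEichlerOrdersTorsionFreeGenusDiscriminant
import Literature.NumberTheory.Automorphic.DefiniteEichlerOrdersUnitIndexClasses
import HarnessLib

/-!
# The definite Eichler orders over `ℚ` of class number two: the complete list of levels
# (Kirschmer–Voight 2010 §8 for `F = ℚ`)

[tag: quaternion_algebra] [tag: class_number] [tag: mass_formula]

Topic `NumberTheory/Automorphic`; THEOREMS ONLY (no definition, no named fact, no instance; net Literature debt `0`).
Lane `lit-hodgefound`, seat p12, gen 49 — the class-number-two companion of `DefiniteEichlerOrdersClassNumberOneLevels.lean`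
(gen 48) and `DefiniteEichlerOrdersTorsionFreeGenus{,Discriminant}.lean` (gen 49). Kirschmer–Voight, *Algorithmic
enumeration of ideal classes for quaternion orders*, §8 «Definite Eichler orders with class number at most two»: «In this
section, we list all definite Eichler orders `O` with `h(O) ≤ 2`. From (massdef) and Proposition (massformula), for such an
order we have `2 ≥ h(O) ≥ M(O) …` which gives a finite list of possible ideals `𝔇, 𝔑`. For each such possibility, we compute the
corresponding class number using the Eichler mass formula … Proposition. There are exactly `76` equivalence classes of definite
Eichler orders with class number `1` and `217` with class number `2`» (over all totally real fields; the tables list `D, N`).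
Here: the base field `ℚ`, in the tree's language of Brandt setups `S : XiSetup N⁺ N⁻` (a definite Eichler order of level `N⁺`
in the quaternion algebra of discriminant `N⁻`, `N⁻` squarefree), by exactly the printed method: the Eichler mass
`φ(N⁻)ψ(N⁺)/12 ≤ h` (`DefiniteEichlerOrdersClassNumberBounds`) bounds the level, the class number formula at level `(M, p)`
(`DefiniteEichlerOrdersClassNumberFormula`, Voight Thm. 30.1.5) and the torsion obstructions of gen 49 evaluate `h`.

* §1 **the composite discriminants `30`, `42`, `66`**, out of reach of the tree's class number formula (`N⁻` prime), by the
  unit-group obstructions of `DefiniteEichlerOrdersTorsionFreeGenusDiscriminant.lean`: a prime `q ≡ 1 (4)` (resp. `q ≡ 1 (3)`)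
  dividing `N⁻` kills the classes of weight `2` (resp. `3`) (`Brandt.XiSetup.natCard_weight_eq_two_eq_zero_of_dvd_nminus`,
  `…_three_…`); with `Σ_c 1∕w_c = h₁ + h₂∕2 + h₃∕3 = mass`: **`h(30) = 2`** (`5 ∣ 30`: no `w = 2`, `h₁ + h₃∕3 = 2∕3` forces
  `(w) = (3, 3)`), **`h(42) = 2`** (`7 ∣ 42`: no `w = 3`, `h₁ + h₂∕2 = 1`, `h ≥ 2` force `(2, 2)`), **`h(66) ≥ 3`** (`5∕3` is not
  `h₁ + h₂∕2 + h₃∕3` with `h₁ + h₂ + h₃ ≤ 2`);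
* §2 the squarefree levels with prime discriminant not yet in the tree: `h(15,2) = h(17,2) = h(23,2) = h(7,3) = h(11,3) =
  h(3,5) = h(3,7) = 2`, `h(13,2) = h(19,2) = 3`, `h(21,2) = h(10,3) = 4` (class number formula), and `h(8,3) = 2` (torsion-free
  genus, `4 ∣ 8`, `2 ≡ 2 (3)`);
* §3 NECESSITY: `h = 2 ⟹ φ(N⁻)ψ(N⁺) ≤ 24 ⟹ (N⁺, N⁻)` is one of `35` candidate levels (`N⁻ ∈ {2,3,5,7,11,13,17,19,23,30,42,66,
  70,78}` by a `decide` over the `512` sets of primes `≤ 23`, then `ψ(N⁺) ≥ N⁺ + 1`), `Brandt.XiSetup.level_mem_candidates_of_natCard_eq_two`;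
* §4 **THE LIST** `Brandt.XiSetup.natCard_classSet_eq_two_iff_level_mem`: **`# Cls O = 2 ⟺ (N⁺, N⁻) ∈ {(7,2), (15,2), (17,2), (23,2),
  (5,3), (7,3), (8,3), (11,3), (3,5), (4,5), (2,7), (3,7), (1,11), (1,17), (1,19), (1,30), (1,42), (1,70), (1,78)}`** (nineteen
  levels; the sixteen other candidates have `h = 1` — the twelve levels of `natCard_classSet_eq_one_iff_level_mem` — or `h ≥ 3`:
  `(13,2), (19,2), (1,23), (1,66)`).

## Sources

* M. Kirschmer, J. Voight, *Algorithmic enumeration of ideal classes for quaternion orders*, SIAM J. Comput. 39 (2010)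
  1714–1747, §8 (quoted; Tables 8.1–8.2, rows `n = 1`). [cite: KirschmerVoight2010, §8 (Prop. 8.1 / Tables 8.1–8.2)]
* J. Voight, *Quaternion Algebras*, GTM 288 (2021), Thm. 30.1.5 (class number formula), Thm. 25.3.18 (mass formula), Thm.
  25.4.3 ∕ Table 25.4.4, Exercise 25.5. [cite: Voight2021, Thm. 30.1.5; Thm. 25.3.18]
* M. Eichler, *Zur Zahlentheorie der Quaternionen-Algebren*, J. reine angew. Math. 195 (1955), §5. [cite: Eichler1955, §5]
* M.-F. Vignéras, LNM 800 (1980), Ch. V §3 Prop. 3.1–3.2 (`h = h₁ + h₂ + h₃`). [cite: VignerasLNM800, Ch. V §3 Prop. 3.2]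

## Scope (honest)

Theorems only; Eichler orders over `ℚ` in the `XiSetup` language (squarefree `N⁻`, `gcd(N⁺, N⁻) = 1`); the non-Eichler (Bass,
non-Gorenstein) orders of Kirschmer–Voight's sequel are outside this language.
-/

noncomputable section

open Finset
open Literature.NumberTheory.Automorphic.Brandt

namespace Literature.NumberTheory.Automorphic

namespace Brandt

variable {Nplus Nminus : ℕ}

/-! ## §1 The composite discriminants `30`, `42`, `66` -/

/-- **A prime `q ≡ 1 (mod 4)` dividing `N⁻` kills the classes of weight `2`**: `h₂ = #{c : w_c = 2} = 0` (a class of weight `2`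
carries a square root of `−1` in `O_L(I_c)`, `Brandt.IsOrder.exists_traceZero_of_unitIndex_eq_two`, impossible by
`mul_self_ne_neg_one_of_dvd`). [cite: Voight2021, Thm. 30.1.5 (ε₂ = 0)] [cite: VignerasLNM800, Ch. III §3 Thm. 3.8] -/
theorem XiSetup.natCard_weight_eq_two_eq_zero_of_dvd_nminus (S : XiSetup Nplus Nminus) {q : ℕ} (hq : q.Prime)
    (hqN : q ∣ Nminus) (h4 : q % 4 = 1) : Nat.card {c : ClassSet S.O // weight S.O c = 2} = 0 := by
  rw [Nat.card_eq_zero]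
  refine Or.inl ⟨fun ⟨c, hc⟩ => ?_⟩
  have hO : IsOrder S.D (leftOrder c.rep) := S.isOrder_leftOrder_rep c
  obtain ⟨x, -, ht, hn⟩ := hO.exists_traceZero_of_unitIndex_eq_two S.isTotallyDefinite hc
  have hxx : x * x = -1 := by
    rw [mul_self_eq_reducedTrace_mul_sub_reducedNorm ℚ S.D x, ht, hn, map_zero, zero_mul, map_one, zero_sub]
  exact S.mul_self_ne_neg_one_of_dvd hq hqN h4 x hxx

/-- **A prime `q ≡ 1 (mod 3)` dividing `N⁻` kills the classes of weight `3`**: `h₃ = #{c : w_c = 3} = 0` (a class of weight `3`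
carries a primitive sixth root of unity `y`, `y² = y − 1`, so `ω = −y` has `ω² + ω + 1 = 0`). [cite: Voight2021, Thm. 30.1.5 (ε₃ = 0)] [cite: VignerasLNM800, Ch. III §3 Thm. 3.8] -/
theorem XiSetup.natCard_weight_eq_three_eq_zero_of_dvd_nminus (S : XiSetup Nplus Nminus) {q : ℕ} (hq : q.Prime)
    (hqN : q ∣ Nminus) (h3 : q % 3 = 1) : Nat.card {c : ClassSet S.O // weight S.O c = 3} = 0 := by
  rw [Nat.card_eq_zero]
  refine Or.inl ⟨fun ⟨c, hc⟩ => ?_⟩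
  have hO : IsOrder S.D (leftOrder c.rep) := S.isOrder_leftOrder_rep c
  obtain ⟨y, -, ht, hn⟩ := hO.exists_traceOne_of_unitIndex_eq_three S.isTotallyDefinite hc
  have hyy : y * y = y - 1 := by
    rw [mul_self_eq_reducedTrace_mul_sub_reducedNorm ℚ S.D y, ht, hn, map_one, one_mul]
  have hω : (-y) * (-y) + (-y) + 1 = 0 := by
    rw [neg_mul_neg, hyy]
    abel
  exact S.sq_add_self_add_one_ne_zero_of_dvd hq hqN h3 (-y) hω

/-- `(30).primeFactors = {2, 3, 5}`. [folklore] -/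
private theorem primeFactors_thirty' : (30 : ℕ).primeFactors = {2, 3, 5} := by
  rw [show (30 : ℕ) = 2 * (3 * 5) from rfl, Nat.primeFactors_mul two_ne_zero (by norm_num),
    Nat.primeFactors_mul (by norm_num) (by norm_num), Nat.prime_two.primeFactors, Nat.prime_three.primeFactors,
    Nat.prime_five.primeFactors]
  decide

/-- `(42).primeFactors = {2, 3, 7}`. [folklore] -/
private theorem primeFactors_fortyTwo' : (42 : ℕ).primeFactors = {2, 3, 7} := by
  rw [show (42 : ℕ) = 2 * (3 * 7) from rfl, Nat.primeFactors_mul two_ne_zero (by norm_num),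
    Nat.primeFactors_mul (by norm_num) (by norm_num), Nat.prime_two.primeFactors, Nat.prime_three.primeFactors,
    (by norm_num : Nat.Prime 7).primeFactors]
  decide

/-- `(66).primeFactors = {2, 3, 11}`. [folklore] -/
private theorem primeFactors_sixtySix' : (66 : ℕ).primeFactors = {2, 3, 11} := by
  rw [show (66 : ℕ) = 2 * (3 * 11) from rfl, Nat.primeFactors_mul two_ne_zero (by norm_num),
    Nat.primeFactors_mul (by norm_num) (by norm_num), Nat.prime_two.primeFactors, Nat.prime_three.primeFactors,
    (by norm_num : Nat.Prime 11).primeFactors]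
  decide

/-- `Σ_c 1∕w_c = h₁ + h₂∕2 + h₃∕3` equals the mass: the two expressions of the total mass of a setup with `N⁻ ∉ {2, 3}`.
[cite: Voight2021, Thm. 25.3.18] [cite: VignerasLNM800, Ch. V §3 Prop. 3.2] -/
theorem XiSetup.natCard_weight_sum_eq_mass (S : XiSetup Nplus Nminus) (h2 : Nminus ≠ 2) (h3 : Nminus ≠ 3) :
    (Nat.card {c : ClassSet S.O // weight S.O c = 1} : ℚ) + (Nat.card {c : ClassSet S.O // weight S.O c = 2} : ℚ) / 2 +
        (Nat.card {c : ClassSet S.O // weight S.O c = 3} : ℚ) / 3 =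
      (1 / 12 : ℚ) * (∏ q ∈ Nminus.primeFactors, ((q : ℚ) - 1)) *
        ∏ p ∈ Nplus.primeFactors, (p : ℚ) ^ (Nplus.factorization p - 1) * ((p : ℚ) + 1) := by
  classical
  letI : Fintype (ClassSet S.O) := Fintype.ofFinite _
  rw [← S.sum_inv_weight_eq_natCard_weight h2 h3, S.massFormula]

/-- **`# Cls O = 2` for the maximal orders of discriminant `30 = 2·3·5`** (Kirschmer–Voight; Voight Exercise 25.5): `5 ≡ 1 (4)`
kills the classes of weight `2`, so `h₁ + h₃∕3 = φ(30)/12 = 2∕3`, forcing `h₁ = 0`, `h₃ = 2`: both classes have `O_L(I)^× ≅ C₆`.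
[cite: KirschmerVoight2010, §8 (Tables 8.1–8.2)] [cite: Voight2021, Thm. 30.1.5 and Exercise 25.5] -/
theorem XiSetup.natCard_classSet_thirty (S : XiSetup 1 30) : Nat.card (ClassSet S.O) = 2 := by
  have hpart := S.natCard_weight_partition (by norm_num) (by norm_num)
  have h2 := S.natCard_weight_eq_two_eq_zero_of_dvd_nminus Nat.prime_five (by norm_num) (by norm_num)
  have hq := S.natCard_weight_sum_eq_mass (by norm_num) (by norm_num)
  rw [h2, primeFactors_thirty', Nat.primeFactors_one, Finset.prod_empty, mul_one, Nat.cast_zero, zero_div, add_zero] at hq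
  have h8 : ∏ q ∈ ({2, 3, 5} : Finset ℕ), ((q : ℚ) - 1) = 8 := by
    simp [Finset.prod_insert, Finset.prod_singleton]
    norm_num
  rw [h8] at hq
  have h3 : (3 * Nat.card {c : ClassSet S.O // weight S.O c = 1} + Nat.card {c : ClassSet S.O // weight S.O c = 3} : ℚ) = 2 := by
    linarith
  have h3' : 3 * Nat.card {c : ClassSet S.O // weight S.O c = 1} + Nat.card {c : ClassSet S.O // weight S.O c = 3} = 2 := by
    exact_mod_cast h3
  omega

/-- **All weights are `3` at discriminant `30`**: `h₃ = 2 = h` (and `h₁ = h₂ = 0`). [cite: KirschmerVoight2010, §8] [cite: Voight2021, Exercise 25.5] -/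
theorem XiSetup.natCard_weight_eq_three_thirty (S : XiSetup 1 30) : Nat.card {c : ClassSet S.O // weight S.O c = 3} = 2 := by
  have hpart := S.natCard_weight_partition (by norm_num) (by norm_num)
  have h2 := S.natCard_weight_eq_two_eq_zero_of_dvd_nminus Nat.prime_five (by norm_num) (by norm_num)
  have hq := S.natCard_weight_sum_eq_mass (by norm_num) (by norm_num)
  rw [h2, primeFactors_thirty', Nat.primeFactors_one, Finset.prod_empty, mul_one, Nat.cast_zero, zero_div, add_zero] at hq
  have h8 : ∏ q ∈ ({2, 3, 5} : Finset ℕ), ((q : ℚ) - 1) = 8 := by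
    simp [Finset.prod_insert, Finset.prod_singleton]
    norm_num
  rw [h8] at hq
  have h3 : (3 * Nat.card {c : ClassSet S.O // weight S.O c = 1} + Nat.card {c : ClassSet S.O // weight S.O c = 3} : ℚ) = 2 := by
    linarith
  have h3' : 3 * Nat.card {c : ClassSet S.O // weight S.O c = 1} + Nat.card {c : ClassSet S.O // weight S.O c = 3} = 2 := by
    exact_mod_cast h3
  omega

/-- **`# Cls O = 2` for the maximal orders of discriminant `42 = 2·3·7`** (Voight Exercise 25.5 (e): «show `# Cls O = 2` for
`disc B = 42`»): `7 ≡ 1 (3)` kills the classes of weight `3`, so `h₁ + h₂∕2 = φ(42)/12 = 1`, and `h ≥ 2`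
(`two_le_natCard_classSet_fortyTwo`) forces `h₁ = 0`, `h₂ = 2`: both classes have `O_L(I)^× ≅ C₄`. [cite: Voight2021, Exercise 25.5 (e)] [cite: KirschmerVoight2010, §8 (Tables 8.1–8.2)] -/
theorem XiSetup.natCard_classSet_fortyTwo (S : XiSetup 1 42) : Nat.card (ClassSet S.O) = 2 := by
  have hpart := S.natCard_weight_partition (by norm_num) (by norm_num)
  have h3 := S.natCard_weight_eq_three_eq_zero_of_dvd_nminus (by norm_num : Nat.Prime 7) (by norm_num) (by norm_num)
  have hge := S.two_le_natCard_classSet_fortyTwo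
  have hq := S.natCard_weight_sum_eq_mass (by norm_num) (by norm_num)
  rw [h3, primeFactors_fortyTwo', Nat.primeFactors_one, Finset.prod_empty, mul_one, Nat.cast_zero, zero_div, add_zero] at hq
  have h12 : ∏ q ∈ ({2, 3, 7} : Finset ℕ), ((q : ℚ) - 1) = 12 := by
    simp [Finset.prod_insert, Finset.prod_singleton]
    norm_num
  rw [h12] at hq
  have h2 : (2 * Nat.card {c : ClassSet S.O // weight S.O c = 1} + Nat.card {c : ClassSet S.O // weight S.O c = 2} : ℚ) = 2 := by
    linarith
  have h2' : 2 * Nat.card {c : ClassSet S.O // weight S.O c = 1} + Nat.card {c : ClassSet S.O // weight S.O c = 2} = 2 := by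
    exact_mod_cast h2
  omega

/-- **All weights are `2` at discriminant `42`**: `h₂ = 2 = h`. [cite: Voight2021, Exercise 25.5 (e)] [cite: KirschmerVoight2010, §8] -/
theorem XiSetup.natCard_weight_eq_two_fortyTwo (S : XiSetup 1 42) : Nat.card {c : ClassSet S.O // weight S.O c = 2} = 2 := by
  have hpart := S.natCard_weight_partition (by norm_num) (by norm_num)
  have h3 := S.natCard_weight_eq_three_eq_zero_of_dvd_nminus (by norm_num : Nat.Prime 7) (by norm_num) (by norm_num)
  have hge := S.two_le_natCard_classSet_fortyTwo
  have hq := S.natCard_weight_sum_eq_mass (by norm_num) (by norm_num)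
  rw [h3, primeFactors_fortyTwo', Nat.primeFactors_one, Finset.prod_empty, mul_one, Nat.cast_zero, zero_div, add_zero] at hq
  have h12 : ∏ q ∈ ({2, 3, 7} : Finset ℕ), ((q : ℚ) - 1) = 12 := by
    simp [Finset.prod_insert, Finset.prod_singleton]
    norm_num
  rw [h12] at hq
  have h2 : (2 * Nat.card {c : ClassSet S.O // weight S.O c = 1} + Nat.card {c : ClassSet S.O // weight S.O c = 2} : ℚ) = 2 := by
    linarith
  have h2' : 2 * Nat.card {c : ClassSet S.O // weight S.O c = 1} + Nat.card {c : ClassSet S.O // weight S.O c = 2} = 2 := by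
    exact_mod_cast h2
  omega

/-- **`3 ≤ # Cls O` for the maximal orders of discriminant `66 = 2·3·11`**: the mass `φ(66)/12 = 5∕3` is not of the form
`h₁ + h₂∕2 + h₃∕3` with `h₁ + h₂ + h₃ ≤ 2` (in fact `h(66) = 4`). [cite: KirschmerVoight2010, §8] [cite: Voight2021, Thm. 30.1.5] -/
theorem XiSetup.three_le_natCard_classSet_sixtySix (S : XiSetup 1 66) : 3 ≤ Nat.card (ClassSet S.O) := by
  have hpart := S.natCard_weight_partition (by norm_num) (by norm_num)
  have hq := S.natCard_weight_sum_eq_mass (by norm_num) (by norm_num)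
  rw [primeFactors_sixtySix', Nat.primeFactors_one, Finset.prod_empty, mul_one] at hq
  have h20 : ∏ q ∈ ({2, 3, 11} : Finset ℕ), ((q : ℚ) - 1) = 20 := by
    simp [Finset.prod_insert, Finset.prod_singleton]
    norm_num
  rw [h20] at hq
  have h : (6 * Nat.card {c : ClassSet S.O // weight S.O c = 1} + 3 * Nat.card {c : ClassSet S.O // weight S.O c = 2} +
      2 * Nat.card {c : ClassSet S.O // weight S.O c = 3} : ℚ) = 10 := by
    linarith
  have h' : 6 * Nat.card {c : ClassSet S.O // weight S.O c = 1} + 3 * Nat.card {c : ClassSet S.O // weight S.O c = 2} +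
      2 * Nat.card {c : ClassSet S.O // weight S.O c = 3} = 10 := by
    exact_mod_cast h
  omega

/-! ## §2 Squarefree levels with prime discriminant (class number formula) and the level `(8, 3)` -/

/-- `15 = 3·5` is squarefree. [folklore] -/
private theorem squarefree_fifteen' : Squarefree (15 : ℕ) := by
  rw [show (15 : ℕ) = 3 * 5 from rfl, Nat.squarefree_mul (by norm_num)]
  exact ⟨Nat.prime_three.squarefree, Nat.prime_five.squarefree⟩

/-- `21 = 3·7` is squarefree. [folklore] -/
private theorem squarefree_twentyOne' : Squarefree (21 : ℕ) := by
  rw [show (21 : ℕ) = 3 * 7 from rfl, Nat.squarefree_mul (by norm_num)]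
  exact ⟨Nat.prime_three.squarefree, (by norm_num : Nat.Prime 7).squarefree⟩

/-- `10 = 2·5` is squarefree. [folklore] -/
private theorem squarefree_ten' : Squarefree (10 : ℕ) := by
  rw [show (10 : ℕ) = 2 * 5 from rfl, Nat.squarefree_mul (by norm_num)]
  exact ⟨Nat.prime_two.squarefree, Nat.prime_five.squarefree⟩

/-- `(15).primeFactors = {3, 5}`. [folklore] -/
private theorem primeFactors_fifteen' : (15 : ℕ).primeFactors = {3, 5} := by
  rw [show (15 : ℕ) = 3 * 5 from rfl, Nat.primeFactors_mul (by norm_num) (by norm_num), Nat.prime_three.primeFactors,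
    Nat.prime_five.primeFactors]
  decide

/-- `(21).primeFactors = {3, 7}`. [folklore] -/
private theorem primeFactors_twentyOne' : (21 : ℕ).primeFactors = {3, 7} := by
  rw [show (21 : ℕ) = 3 * 7 from rfl, Nat.primeFactors_mul (by norm_num) (by norm_num), Nat.prime_three.primeFactors,
    (by norm_num : Nat.Prime 7).primeFactors]
  decide

/-- `(10).primeFactors = {2, 5}`. [folklore] -/
private theorem primeFactors_ten' : (10 : ℕ).primeFactors = {2, 5} := by
  rw [show (10 : ℕ) = 2 * 5 from rfl, Nat.primeFactors_mul (by norm_num) (by norm_num), Nat.prime_two.primeFactors,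
    Nat.prime_five.primeFactors]
  decide

/-- **`h(15, 2) = 2`** (`12h = ψ(15) + 3ρ₃(0,1)ρ₅(0,1) + 8ρ₃(1,1)ρ₅(1,1) = 24 + 0 + 0`). [cite: Voight2021, Thm. 30.1.5] [cite: KirschmerVoight2010, §8 (Table 8.2)] -/
theorem XiSetup.natCard_classSet_level_fifteen_two (S : XiSetup 15 2) : Nat.card (ClassSet S.O) = 2 := by
  have h := S.twelve_mul_natCard_classSet_eq_of_squarefree squarefree_fifteen' Nat.prime_two (by norm_num)
  rw [primeFactors_fifteen', show ∏ q ∈ ({3, 5} : Finset ℕ), (q + 1) = 24 by decide,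
    show ∏ q ∈ ({3, 5} : Finset ℕ), rho q 0 1 = 0 by decide, show ∏ q ∈ ({3, 5} : Finset ℕ), rho q 1 1 = 0 by decide] at h
  omega

/-- **`h(17, 2) = 2`** (`12h = 18 + 3·ρ₁₇(0,1) + 8·ρ₁₇(1,1) = 18 + 6 + 0`). [cite: Voight2021, Thm. 30.1.5] [cite: KirschmerVoight2010, §8 (Table 8.2)] -/
theorem XiSetup.natCard_classSet_level_seventeen_two (S : XiSetup 17 2) : Nat.card (ClassSet S.O) = 2 := by
  have h := S.twelve_mul_natCard_classSet_eq_of_squarefree (by norm_num : Nat.Prime 17).squarefree Nat.prime_two (by norm_num)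
  rw [(by norm_num : Nat.Prime 17).primeFactors, Finset.prod_singleton, Finset.prod_singleton, Finset.prod_singleton,
    show rho 2 0 1 = 1 by decide, show rho 17 0 1 = 2 by decide, show rho 2 1 1 = 0 by decide,
    show rho 17 1 1 = 0 by decide] at h
  omega

/-- **`h(23, 2) = 2`** (`12h = 24 + 0 + 0`: `23 ≡ 3 (4)`, `23 ≡ 2 (3)` — a torsion-free genus). [cite: Voight2021, Thm. 30.1.5] [cite: KirschmerVoight2010, §8 (Table 8.2)] -/
theorem XiSetup.natCard_classSet_level_twentyThree_two (S : XiSetup 23 2) : Nat.card (ClassSet S.O) = 2 := by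
  have h := S.twelve_mul_natCard_classSet_eq_of_squarefree (by norm_num : Nat.Prime 23).squarefree Nat.prime_two (by norm_num)
  rw [(by norm_num : Nat.Prime 23).primeFactors, Finset.prod_singleton, Finset.prod_singleton, Finset.prod_singleton,
    show rho 23 0 1 = 0 by decide, show rho 23 1 1 = 0 by decide] at h
  omega

/-- **`h(13, 2) = 3`** (`12h = 14 + 3·2 + 8·2 = 36`). [cite: Voight2021, Thm. 30.1.5] [cite: KirschmerVoight2010, §8] -/
theorem XiSetup.natCard_classSet_level_thirteen_two (S : XiSetup 13 2) : Nat.card (ClassSet S.O) = 3 := by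
  have h := S.twelve_mul_natCard_classSet_eq_of_squarefree (by norm_num : Nat.Prime 13).squarefree Nat.prime_two (by norm_num)
  rw [(by norm_num : Nat.Prime 13).primeFactors, Finset.prod_singleton, Finset.prod_singleton, Finset.prod_singleton,
    show rho 2 0 1 = 1 by decide, show rho 13 0 1 = 2 by decide, show rho 2 1 1 = 0 by decide,
    show rho 13 1 1 = 2 by decide] at h
  omega

/-- **`h(19, 2) = 3`** (`12h = 20 + 0 + 8·2 = 36`). [cite: Voight2021, Thm. 30.1.5] [cite: KirschmerVoight2010, §8] -/
theorem XiSetup.natCard_classSet_level_nineteen_two (S : XiSetup 19 2) : Nat.card (ClassSet S.O) = 3 := by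
  have h := S.twelve_mul_natCard_classSet_eq_of_squarefree (by norm_num : Nat.Prime 19).squarefree Nat.prime_two (by norm_num)
  rw [(by norm_num : Nat.Prime 19).primeFactors, Finset.prod_singleton, Finset.prod_singleton, Finset.prod_singleton,
    show rho 2 0 1 = 1 by decide, show rho 19 0 1 = 0 by decide, show rho 2 1 1 = 0 by decide,
    show rho 19 1 1 = 2 by decide] at h
  omega

/-- **`h(21, 2) = 4`** (`12h = ψ(21) + 3ρ₃ρ₇(0,1) + 8ρ₃ρ₇(1,1) = 32 + 0 + 16`). [cite: Voight2021, Thm. 30.1.5] [cite: KirschmerVoight2010, §8] -/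
theorem XiSetup.natCard_classSet_level_twentyOne_two (S : XiSetup 21 2) : Nat.card (ClassSet S.O) = 4 := by
  have h := S.twelve_mul_natCard_classSet_eq_of_squarefree squarefree_twentyOne' Nat.prime_two (by norm_num)
  rw [primeFactors_twentyOne', show ∏ q ∈ ({3, 7} : Finset ℕ), (q + 1) = 32 by decide,
    show ∏ q ∈ ({3, 7} : Finset ℕ), rho q 0 1 = 0 by decide, show ∏ q ∈ ({3, 7} : Finset ℕ), rho q 1 1 = 2 by decide,
    show rho 2 0 1 = 1 by decide, show rho 2 1 1 = 0 by decide] at h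
  omega

/-- **`h(7, 3) = 2`** (`12h = 2·8 + 6·ρ₇(0,1) + 4·ρ₇(1,1) = 16 + 0 + 8`). [cite: Voight2021, Thm. 30.1.5] [cite: KirschmerVoight2010, §8 (Table 8.2)] -/
theorem XiSetup.natCard_classSet_level_seven_three (S : XiSetup 7 3) : Nat.card (ClassSet S.O) = 2 := by
  have h := S.twelve_mul_natCard_classSet_eq_of_squarefree (by norm_num : Nat.Prime 7).squarefree Nat.prime_three (by norm_num)
  rw [(by norm_num : Nat.Prime 7).primeFactors, Finset.prod_singleton, Finset.prod_singleton, Finset.prod_singleton,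
    show rho 3 0 1 = 0 by decide, show rho 7 0 1 = 0 by decide, show rho 3 1 1 = 1 by decide,
    show rho 7 1 1 = 2 by decide] at h
  omega

/-- **`h(11, 3) = 2`** (`12h = 2·12 + 0 + 0`). [cite: Voight2021, Thm. 30.1.5] [cite: KirschmerVoight2010, §8 (Table 8.2)] -/
theorem XiSetup.natCard_classSet_level_eleven_three (S : XiSetup 11 3) : Nat.card (ClassSet S.O) = 2 := by
  have h := S.twelve_mul_natCard_classSet_eq_of_squarefree (by norm_num : Nat.Prime 11).squarefree Nat.prime_three (by norm_num)
  rw [(by norm_num : Nat.Prime 11).primeFactors, Finset.prod_singleton, Finset.prod_singleton, Finset.prod_singleton,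
    show rho 11 0 1 = 0 by decide, show rho 11 1 1 = 0 by decide] at h
  omega

/-- **`h(10, 3) = 4`** (`12h = (3−1)ψ(10) + 3(2 − ρ₃(0,1))ρ₂(0,1)ρ₅(0,1) + 4(2 − ρ₃(1,1))ρ₂(1,1)ρ₅(1,1) = 36 + 3·2·1·2 + 0 = 48`).
[cite: Voight2021, Thm. 30.1.5] [cite: KirschmerVoight2010, §8] -/
theorem XiSetup.natCard_classSet_level_ten_three (S : XiSetup 10 3) : Nat.card (ClassSet S.O) = 4 := by
  have h := S.twelve_mul_natCard_classSet_eq_of_squarefree squarefree_ten' Nat.prime_three (by norm_num)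
  rw [primeFactors_ten', show ∏ q ∈ ({2, 5} : Finset ℕ), (q + 1) = 18 by decide,
    show ∏ q ∈ ({2, 5} : Finset ℕ), rho q 0 1 = 2 by decide, show ∏ q ∈ ({2, 5} : Finset ℕ), rho q 1 1 = 0 by decide,
    show rho 3 0 1 = 0 by decide, show rho 3 1 1 = 1 by decide] at h
  omega

/-- **`h(3, 5) = 2`** (`12h = 4·4 + 0 + 8·ρ₃(1,1) = 16 + 8`). [cite: Voight2021, Thm. 30.1.5] [cite: KirschmerVoight2010, §8 (Table 8.2)] -/
theorem XiSetup.natCard_classSet_level_three_five (S : XiSetup 3 5) : Nat.card (ClassSet S.O) = 2 := by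
  have h := S.twelve_mul_natCard_classSet_eq_of_squarefree Nat.prime_three.squarefree Nat.prime_five (by norm_num)
  rw [Nat.prime_three.primeFactors, Finset.prod_singleton, Finset.prod_singleton, Finset.prod_singleton,
    show rho 5 0 1 = 2 by decide, show rho 3 0 1 = 0 by decide, show rho 5 1 1 = 0 by decide,
    show rho 3 1 1 = 1 by decide] at h
  omega

/-- **`h(3, 7) = 2`** (`12h = 6·4 + 6·ρ₃(0,1) + 0 = 24`). [cite: Voight2021, Thm. 30.1.5] [cite: KirschmerVoight2010, §8 (Table 8.2)] -/
theorem XiSetup.natCard_classSet_level_three_seven (S : XiSetup 3 7) : Nat.card (ClassSet S.O) = 2 := by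
  have h := S.twelve_mul_natCard_classSet_eq_of_squarefree Nat.prime_three.squarefree (by norm_num : Nat.Prime 7) (by norm_num)
  rw [Nat.prime_three.primeFactors, Finset.prod_singleton, Finset.prod_singleton, Finset.prod_singleton,
    show rho 7 0 1 = 0 by decide, show rho 3 0 1 = 0 by decide, show rho 7 1 1 = 2 by decide,
    show rho 3 1 1 = 1 by decide] at h
  omega

/-- `12 · mass(8, 3) = φ(3) ψ(8) = 2 · 12`. [folklore] -/
private theorem mass_eight_three' :
    (∏ q ∈ (3 : ℕ).primeFactors, (q - 1)) * ∏ p ∈ (8 : ℕ).primeFactors, p ^ ((8 : ℕ).factorization p - 1) * (p + 1) = 24 := by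
  rw [Nat.prime_three.primeFactors, show (8 : ℕ) = 2 ^ 3 from rfl, Nat.primeFactors_prime_pow three_ne_zero Nat.prime_two,
    Nat.Prime.factorization_pow Nat.prime_two]
  simp

/-- **`h(8, 3) = 2`** (a torsion-free genus: `4 ∣ 8` kills `i`, the prime `2 ≡ 2 (3)` of the level kills `ω`; `φ(3)ψ(8) = 24`).
[cite: Voight2021, Thm. 30.1.5 (ε₂ = ε₃ = 0)] [cite: KirschmerVoight2010, §8 (Table 8.2)] -/
theorem XiSetup.natCard_classSet_level_eight_three (S : XiSetup 8 3) : Nat.card (ClassSet S.O) = 2 := by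
  have h := S.twelve_mul_natCard_classSet_eq_of_eps_eq_zero (Or.inr (Or.inl (by norm_num)))
    (Or.inr (Or.inr ⟨2, Nat.prime_two, by norm_num, by norm_num⟩))
  rw [mass_eight_three'] at h
  omega

/-! ## §3 Necessity: `h = 2 ⟹` one of thirty-five candidate levels -/

/-- `∏ (f + g) ≥ ∏ f + ∏ g` over a nonempty finite set (in `ℕ`). [folklore] -/
private theorem prod_add_ge'' {ι : Type*} {s : Finset ι} (hs : s.Nonempty) (f g : ι → ℕ) :
    ∏ i ∈ s, f i + ∏ i ∈ s, g i ≤ ∏ i ∈ s, (f i + g i) := by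
  induction hs using Finset.Nonempty.cons_induction with
  | singleton a => simp
  | cons a s ha hs ih =>
    rw [Finset.prod_cons, Finset.prod_cons, Finset.prod_cons]
    calc f a * ∏ i ∈ s, f i + g a * ∏ i ∈ s, g i
        ≤ f a * ∏ i ∈ s, (f i + g i) + g a * ∏ i ∈ s, (f i + g i) :=
          Nat.add_le_add (Nat.mul_le_mul_left _ (le_trans (Nat.le_add_right _ _) ih))
            (Nat.mul_le_mul_left _ (le_trans (Nat.le_add_left _ _) ih))
      _ = (f a + g a) * ∏ i ∈ s, (f i + g i) := by ring

/-- **`ψ(N) ≥ N + 1` for `N ≥ 2`.** [folklore] [cite: Voight2021, proof of Thm. 25.4.3] -/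
private theorem succ_le_psiProd'' {N : ℕ} (hN : 2 ≤ N) :
    N + 1 ≤ ∏ p ∈ N.primeFactors, p ^ (N.factorization p - 1) * (p + 1) := by
  have hN0 : N ≠ 0 := by omega
  have hne : N.primeFactors.Nonempty := Nat.nonempty_primeFactors.mpr hN
  have hterm : ∀ p ∈ N.primeFactors,
      p ^ (N.factorization p - 1) * (p + 1) = p ^ N.factorization p + p ^ (N.factorization p - 1) := by
    intro p hp
    have hk : 1 ≤ N.factorization p :=
      (Nat.prime_of_mem_primeFactors hp).factorization_pos_of_dvd hN0 (Nat.dvd_of_mem_primeFactors hp)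
    calc p ^ (N.factorization p - 1) * (p + 1) = p ^ (N.factorization p - 1) * p + p ^ (N.factorization p - 1) := by ring
      _ = p ^ N.factorization p + p ^ (N.factorization p - 1) := by rw [← pow_succ, Nat.sub_add_cancel hk]
  rw [Finset.prod_congr rfl hterm]
  calc N + 1 = (∏ p ∈ N.primeFactors, p ^ N.factorization p) + 1 := by rw [← Nat.prod_primeFactors_pow_factorization hN0]
    _ ≤ (∏ p ∈ N.primeFactors, p ^ N.factorization p) + ∏ p ∈ N.primeFactors, p ^ (N.factorization p - 1) :=
        Nat.add_le_add_left (Finset.one_le_prod' fun p hp => Nat.one_le_pow _ _ (Nat.prime_of_mem_primeFactors hp).pos) _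
    _ ≤ _ := prod_add_ge'' hne _ _

/-- Each factor `p^{k−1}(p + 1)` is `≥ 1`. [folklore] -/
private theorem one_le_psiFactor''' (N p : ℕ) : 1 ≤ p ^ (N.factorization p - 1) * (p + 1) := by
  rcases Nat.eq_zero_or_pos p with rfl | hp
  · rw [Nat.factorization_zero_right, Nat.zero_sub, pow_zero, one_mul, zero_add]
  · exact Nat.one_le_iff_ne_zero.mpr (mul_ne_zero (pow_ne_zero _ hp.ne') (Nat.succ_ne_zero p))

/-- For squarefree `N`: `∏_{p∣N} p^{v_p(N)−1}(p + 1) = ∏_{p∣N}(p + 1)`. [folklore] -/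
private theorem psiProd_eq_of_squarefree' {N : ℕ} (hsq : Squarefree N) :
    ∏ p ∈ N.primeFactors, p ^ (N.factorization p - 1) * (p + 1) = ∏ p ∈ N.primeFactors, (p + 1) := by
  refine Finset.prod_congr rfl fun p hp => ?_
  have h1 : N.factorization p = 1 :=
    le_antisymm (hsq.natFactorization_le_one p)
      ((Nat.prime_of_mem_primeFactors hp).factorization_pos_of_dvd hsq.ne_zero (Nat.dvd_of_mem_primeFactors hp))
  rw [h1, Nat.sub_self, pow_zero, one_mul]

/-- **A prime `q ∣ N⁻` has `q − 1 ≤ 12 · # Cls O`** (each factor of `φ(N⁻)ψ(N⁺) ≤ 12h` is `≥ 1`). [cite: Eichler1955, §5] [cite: Voight2021, Thm. 25.3.18] -/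
theorem XiSetup.sub_one_le_twelve_mul_natCard_classSet (S : XiSetup Nplus Nminus) {q : ℕ} (hq : q.Prime)
    (hqN : q ∣ Nminus) : q - 1 ≤ 12 * Nat.card (ClassSet S.O) := by
  have h := S.prod_le_twelve_mul_natCard_classSet
  have hmem : q ∈ Nminus.primeFactors := Nat.mem_primeFactors.mpr ⟨hq, hqN, S.squarefree.ne_zero⟩
  have h1 : q - 1 ≤ ∏ r ∈ Nminus.primeFactors, (r - 1) :=
    Finset.single_le_prod' (fun r hr => Nat.le_sub_one_of_lt (Nat.prime_of_mem_primeFactors hr).one_lt) hmem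
  have h2 : 1 ≤ ∏ p ∈ Nplus.primeFactors, p ^ (Nplus.factorization p - 1) * (p + 1) :=
    Finset.one_le_prod' fun p _ => one_le_psiFactor''' Nplus p
  calc q - 1 ≤ (∏ r ∈ Nminus.primeFactors, (r - 1)) * 1 := by rw [mul_one]; exact h1
    _ ≤ (∏ r ∈ Nminus.primeFactors, (r - 1)) * ∏ p ∈ Nplus.primeFactors, p ^ (Nplus.factorization p - 1) * (p + 1) :=
        Nat.mul_le_mul_left _ h2
    _ ≤ _ := h

/-- The squarefree `D` with an odd number of prime factors, all `≤ 23`, and `φ(D) ≤ 24`: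
`D ∈ {2, 3, 5, 7, 11, 13, 17, 19, 23, 30, 42, 66, 70, 78}` — as sets of prime factors (a finite check over the `512` subsets of
the primes `≤ 23`). [cite: KirschmerVoight2010, §8 (the finite list of possible 𝔇)] -/
private theorem primeFactors_cases_two' : ∀ s ∈ (({2, 3, 5, 7, 11, 13, 17, 19, 23} : Finset ℕ)).powerset,
    ∏ q ∈ s, (q - 1) ≤ 24 → Odd s.card →
      s = {2} ∨ s = {3} ∨ s = {5} ∨ s = {7} ∨ s = {11} ∨ s = {13} ∨ s = {17} ∨ s = {19} ∨ s = {23} ∨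
        s = {2, 3, 5} ∨ s = {2, 3, 7} ∨ s = {2, 3, 11} ∨ s = {2, 5, 7} ∨ s = {2, 3, 13} := by
  decide +kernel

/-- The arithmetic of the candidate list: `A ≥ 1` coprime to the squarefree `B` with an odd number of prime factors all
`≤ 23`, and `φ(B)ψ(A) ≤ 24`, force `(A, B)` into thirty-five levels. [cite: KirschmerVoight2010, §8] -/
private theorem level_mem_candidates_two_arith' {A B : ℕ} (hA : 0 < A) (hcop : Nat.Coprime A B) (hsq : Squarefree B)
    (hodd : Odd B.primeFactors.card) (h25 : ∀ q ∈ B.primeFactors, q ≤ 25)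
    (hprod : (∏ q ∈ B.primeFactors, (q - 1)) * ∏ p ∈ A.primeFactors, p ^ (A.factorization p - 1) * (p + 1) ≤ 24) :
    (A, B) ∈ ({(1, 2), (3, 2), (5, 2), (7, 2), (9, 2), (11, 2), (13, 2), (15, 2), (17, 2), (19, 2), (23, 2),
      (1, 3), (2, 3), (4, 3), (5, 3), (7, 3), (8, 3), (11, 3), (1, 5), (2, 5), (3, 5), (4, 5), (1, 7), (2, 7), (3, 7),
      (1, 11), (1, 13), (1, 17), (1, 19), (1, 23), (1, 30), (1, 42), (1, 66), (1, 70), (1, 78)} : Finset (ℕ × ℕ)) := by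
  -- the prime factors of `B`
  have hsub : B.primeFactors ∈ (({2, 3, 5, 7, 11, 13, 17, 19, 23} : Finset ℕ)).powerset := by
    rw [Finset.mem_powerset]
    intro q hq
    have hqp := Nat.prime_of_mem_primeFactors hq
    have hq25 := h25 q hq
    have hq2 := hqp.two_le
    interval_cases q <;> first | decide | exact absurd hqp (by decide)
  have hψ1 : 1 ≤ ∏ p ∈ A.primeFactors, p ^ (A.factorization p - 1) * (p + 1) :=
    Finset.one_le_prod' fun p _ => one_le_psiFactor''' A p
  have hφ : ∏ q ∈ B.primeFactors, (q - 1) ≤ 24 :=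
    le_trans (Nat.le_mul_of_pos_right _ hψ1) hprod
  have hB : ∏ q ∈ B.primeFactors, q = B := Nat.prod_primeFactors_of_squarefree hsq
  -- `ψ(A) ≥ A + 1` unless `A = 1`
  have hAψ : A = 1 ∨ (2 ≤ A ∧ A + 1 ≤ ∏ p ∈ A.primeFactors, p ^ (A.factorization p - 1) * (p + 1)) := by
    rcases Nat.lt_or_ge A 2 with h | h
    · exact Or.inl (by omega)
    · exact Or.inr ⟨h, succ_le_psiProd'' h⟩
  have hψ21 : ∏ p ∈ (21 : ℕ).primeFactors, p ^ ((21 : ℕ).factorization p - 1) * (p + 1) = 32 := by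
    rw [psiProd_eq_of_squarefree' squarefree_twentyOne', primeFactors_twentyOne']
    decide
  have hψ10 : ∏ p ∈ (10 : ℕ).primeFactors, p ^ ((10 : ℕ).factorization p - 1) * (p + 1) = 18 := by
    rw [psiProd_eq_of_squarefree' squarefree_ten', primeFactors_ten']
    decide
  rcases primeFactors_cases_two' _ hsub hφ hodd with hs | hs | hs | hs | hs | hs | hs | hs | hs | hs | hs | hs | hs | hs <;>
    rw [hs] at hB hprod
  -- `B = 2`: `ψ(A) ≤ 24`, `A` odd, `A ≤ 23`
  · have hB' : B = 2 := by rw [← hB]; decide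
    subst hB'
    rw [show ∏ q ∈ ({2} : Finset ℕ), (q - 1) = 1 by decide, one_mul] at hprod
    rcases hAψ with rfl | ⟨hA2, hAψ⟩
    · decide
    · have hA23 : A ≤ 23 := by omega
      by_cases hA21 : A = 21
      · subst hA21
        rw [hψ21] at hprod
        omega
      interval_cases A <;> first | decide | omega | exact absurd hcop (by norm_num)
  -- `B = 3`: `ψ(A) ≤ 12`
  · have hB' : B = 3 := by rw [← hB]; decide
    subst hB'
    rw [show ∏ q ∈ ({3} : Finset ℕ), (q - 1) = 2 by decide] at hprod
    rcases hAψ with rfl | ⟨hA2, hAψ⟩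
    · decide
    · have hA11 : A ≤ 11 := by omega
      by_cases hA10 : A = 10
      · subst hA10
        rw [hψ10] at hprod
        omega
      interval_cases A <;> first | decide | omega | exact absurd hcop (by norm_num)
  -- `B = 5`: `ψ(A) ≤ 6`
  · have hB' : B = 5 := by rw [← hB]; decide
    subst hB'
    rw [show ∏ q ∈ ({5} : Finset ℕ), (q - 1) = 4 by decide] at hprod
    rcases hAψ with rfl | ⟨hA2, hAψ⟩
    · decide
    · have hA5 : A ≤ 5 := by omega
      interval_cases A <;> first | decide | exact absurd hcop (by norm_num)
  -- `B = 7`: `ψ(A) ≤ 4`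
  · have hB' : B = 7 := by rw [← hB]; decide
    subst hB'
    rw [show ∏ q ∈ ({7} : Finset ℕ), (q - 1) = 6 by decide] at hprod
    rcases hAψ with rfl | ⟨hA2, hAψ⟩
    · decide
    · have hA3 : A ≤ 3 := by omega
      interval_cases A <;> decide
  -- `B = 11, 13, 17, 19, 23`: `A = 1`
  · have hB' : B = 11 := by rw [← hB]; decide
    subst hB'
    rw [show ∏ q ∈ ({11} : Finset ℕ), (q - 1) = 10 by decide] at hprod
    rcases hAψ with rfl | ⟨hA2, hAψ⟩
    · decide
    · omega
  · have hB' : B = 13 := by rw [← hB]; decide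
    subst hB'
    rw [show ∏ q ∈ ({13} : Finset ℕ), (q - 1) = 12 by decide] at hprod
    rcases hAψ with rfl | ⟨hA2, hAψ⟩
    · decide
    · omega
  · have hB' : B = 17 := by rw [← hB]; decide
    subst hB'
    rw [show ∏ q ∈ ({17} : Finset ℕ), (q - 1) = 16 by decide] at hprod
    rcases hAψ with rfl | ⟨hA2, hAψ⟩
    · decide
    · omega
  · have hB' : B = 19 := by rw [← hB]; decide
    subst hB'
    rw [show ∏ q ∈ ({19} : Finset ℕ), (q - 1) = 18 by decide] at hprod
    rcases hAψ with rfl | ⟨hA2, hAψ⟩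
    · decide
    · omega
  · have hB' : B = 23 := by rw [← hB]; decide
    subst hB'
    rw [show ∏ q ∈ ({23} : Finset ℕ), (q - 1) = 22 by decide] at hprod
    rcases hAψ with rfl | ⟨hA2, hAψ⟩
    · decide
    · omega
  -- `B = 30, 42, 66, 70, 78`: `A = 1`
  · have hB' : B = 30 := by rw [← hB]; decide
    subst hB'
    rw [show ∏ q ∈ ({2, 3, 5} : Finset ℕ), (q - 1) = 8 by decide] at hprod
    rcases hAψ with rfl | ⟨hA2, hAψ⟩
    · decide
    · have hA2' : A ≤ 2 := by omega
      interval_cases A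
      exact absurd hcop (by norm_num)
  · have hB' : B = 42 := by rw [← hB]; decide
    subst hB'
    rw [show ∏ q ∈ ({2, 3, 7} : Finset ℕ), (q - 1) = 12 by decide] at hprod
    rcases hAψ with rfl | ⟨hA2, hAψ⟩
    · decide
    · omega
  · have hB' : B = 66 := by rw [← hB]; decide
    subst hB'
    rw [show ∏ q ∈ ({2, 3, 11} : Finset ℕ), (q - 1) = 20 by decide] at hprod
    rcases hAψ with rfl | ⟨hA2, hAψ⟩
    · decide
    · omega
  · have hB' : B = 70 := by rw [← hB]; decide
    subst hB'
    rw [show ∏ q ∈ ({2, 5, 7} : Finset ℕ), (q - 1) = 24 by decide] at hprod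
    rcases hAψ with rfl | ⟨hA2, hAψ⟩
    · decide
    · omega
  · have hB' : B = 78 := by rw [← hB]; decide
    subst hB'
    rw [show ∏ q ∈ ({2, 3, 13} : Finset ℕ), (q - 1) = 24 by decide] at hprod
    rcases hAψ with rfl | ⟨hA2, hAψ⟩
    · decide
    · omega

/-- **`# Cls O = 2 ⟹ (N⁺, N⁻)` is one of thirty-five levels with `φ(N⁻)ψ(N⁺) ≤ 24`** (Kirschmer–Voight's «finite list of
possible ideals `𝔇, 𝔑`» for `F = ℚ`). [cite: KirschmerVoight2010, §8] [cite: Eichler1955, §5] -/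
theorem XiSetup.level_mem_candidates_of_natCard_eq_two (S : XiSetup Nplus Nminus) (h : Nat.card (ClassSet S.O) = 2) :
    (Nplus, Nminus) ∈ ({(1, 2), (3, 2), (5, 2), (7, 2), (9, 2), (11, 2), (13, 2), (15, 2), (17, 2), (19, 2), (23, 2),
      (1, 3), (2, 3), (4, 3), (5, 3), (7, 3), (8, 3), (11, 3), (1, 5), (2, 5), (3, 5), (4, 5), (1, 7), (2, 7), (3, 7),
      (1, 11), (1, 13), (1, 17), (1, 19), (1, 23), (1, 30), (1, 42), (1, 66), (1, 70), (1, 78)} : Finset (ℕ × ℕ)) := by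
  have hprod := S.prod_le_twelve_mul_natCard_classSet
  rw [h] at hprod
  refine level_mem_candidates_two_arith' S.nplus_pos S.coprime S.squarefree S.odd_card_primeFactors (fun q hq => ?_) hprod
  have h1 := S.sub_one_le_twelve_mul_natCard_classSet (Nat.prime_of_mem_primeFactors hq) (Nat.dvd_of_mem_primeFactors hq)
  rw [h] at h1
  omega

/-! ## §4 The list -/

/-- **Class number two at the nineteen levels** `(7,2), (15,2), (17,2), (23,2), (5,3), (7,3), (8,3), (11,3), (3,5), (4,5), (2,7),
(3,7), (1,11), (1,17), (1,19), (1,30), (1,42), (1,70), (1,78)`. [cite: KirschmerVoight2010, §8 (Table 8.2)] [cite: Voight2021, Thm. 30.1.5] -/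
theorem XiSetup.natCard_classSet_eq_two_of_level_mem (S : XiSetup Nplus Nminus)
    (h : (Nplus, Nminus) ∈ ({(7, 2), (15, 2), (17, 2), (23, 2), (5, 3), (7, 3), (8, 3), (11, 3), (3, 5), (4, 5), (2, 7),
      (3, 7), (1, 11), (1, 17), (1, 19), (1, 30), (1, 42), (1, 70), (1, 78)} : Finset (ℕ × ℕ))) :
    Nat.card (ClassSet S.O) = 2 := by
  simp only [Finset.mem_insert, Finset.mem_singleton, Prod.mk.injEq] at h
  rcases h with ⟨rfl, rfl⟩ | ⟨rfl, rfl⟩ | ⟨rfl, rfl⟩ | ⟨rfl, rfl⟩ | ⟨rfl, rfl⟩ | ⟨rfl, rfl⟩ | ⟨rfl, rfl⟩ | ⟨rfl, rfl⟩ |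
    ⟨rfl, rfl⟩ | ⟨rfl, rfl⟩ | ⟨rfl, rfl⟩ | ⟨rfl, rfl⟩ | ⟨rfl, rfl⟩ | ⟨rfl, rfl⟩ | ⟨rfl, rfl⟩ | ⟨rfl, rfl⟩ | ⟨rfl, rfl⟩ |
    ⟨rfl, rfl⟩ | ⟨rfl, rfl⟩
  · exact S.natCard_classSet_level_seven_two
  · exact S.natCard_classSet_level_fifteen_two
  · exact S.natCard_classSet_level_seventeen_two
  · exact S.natCard_classSet_level_twentyThree_two
  · exact S.natCard_classSet_level_five_three
  · exact S.natCard_classSet_level_seven_three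
  · exact S.natCard_classSet_level_eight_three
  · exact S.natCard_classSet_level_eleven_three
  · exact S.natCard_classSet_level_three_five
  · exact S.natCard_classSet_level_four_five
  · exact S.natCard_classSet_level_two_seven
  · exact S.natCard_classSet_level_three_seven
  · exact S.natCard_classSet_eleven
  · exact S.natCard_classSet_seventeen
  · exact S.natCard_classSet_nineteen
  · exact S.natCard_classSet_thirty
  · exact S.natCard_classSet_fortyTwo
  · exact S.natCard_classSet_seventy
  · exact S.natCard_classSet_seventyEight

/-- **THE DEFINITE EICHLER ORDERS OVER `ℚ` OF CLASS NUMBER TWO** (Kirschmer–Voight 2010 §8, the rows over `F = ℚ` of their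
Table 8.2, Eichler orders): a Brandt setup of type `(N⁺, N⁻)` — a definite Eichler order of level `N⁺` in the quaternion
algebra of discriminant `N⁻` over `ℚ` — has **`# Cls O = 2` if and only if `(N⁺, N⁻) ∈ {(7,2), (15,2), (17,2), (23,2), (5,3),
(7,3), (8,3), (11,3), (3,5), (4,5), (2,7), (3,7), (1,11), (1,17), (1,19), (1,30), (1,42), (1,70), (1,78)}`**, i.e.
`(D, N) = (N⁻, N⁺N⁻) ∈ {(2,14), (2,30), (2,34), (2,46), (3,15), (3,21), (3,24), (3,33), (5,15), (5,20), (7,14), (7,21), (11,11),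
(17,17), (19,19), (30,30), (42,42), (70,70), (78,78)}`. [cite: KirschmerVoight2010, §8 (Prop. 8.1, Table 8.2)] [cite: Voight2021, Thm. 30.1.5 and Thm. 25.3.18] [cite: Eichler1955, §5] -/
theorem XiSetup.natCard_classSet_eq_two_iff_level_mem (S : XiSetup Nplus Nminus) :
    Nat.card (ClassSet S.O) = 2 ↔
      (Nplus, Nminus) ∈ ({(7, 2), (15, 2), (17, 2), (23, 2), (5, 3), (7, 3), (8, 3), (11, 3), (3, 5), (4, 5), (2, 7),
        (3, 7), (1, 11), (1, 17), (1, 19), (1, 30), (1, 42), (1, 70), (1, 78)} : Finset (ℕ × ℕ)) := by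
  refine ⟨fun h => ?_, S.natCard_classSet_eq_two_of_level_mem⟩
  have h35 := S.level_mem_candidates_of_natCard_eq_two h
  simp only [Finset.mem_insert, Finset.mem_singleton, Prod.mk.injEq] at h35
  rcases h35 with ⟨rfl, rfl⟩ | ⟨rfl, rfl⟩ | ⟨rfl, rfl⟩ | ⟨rfl, rfl⟩ | ⟨rfl, rfl⟩ | ⟨rfl, rfl⟩ | ⟨rfl, rfl⟩ | ⟨rfl, rfl⟩ |
    ⟨rfl, rfl⟩ | ⟨rfl, rfl⟩ | ⟨rfl, rfl⟩ | ⟨rfl, rfl⟩ | ⟨rfl, rfl⟩ | ⟨rfl, rfl⟩ | ⟨rfl, rfl⟩ | ⟨rfl, rfl⟩ | ⟨rfl, rfl⟩ |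
    ⟨rfl, rfl⟩ | ⟨rfl, rfl⟩ | ⟨rfl, rfl⟩ | ⟨rfl, rfl⟩ | ⟨rfl, rfl⟩ | ⟨rfl, rfl⟩ | ⟨rfl, rfl⟩ | ⟨rfl, rfl⟩ | ⟨rfl, rfl⟩ |
    ⟨rfl, rfl⟩ | ⟨rfl, rfl⟩ | ⟨rfl, rfl⟩ | ⟨rfl, rfl⟩ | ⟨rfl, rfl⟩ | ⟨rfl, rfl⟩ | ⟨rfl, rfl⟩ | ⟨rfl, rfl⟩ | ⟨rfl, rfl⟩
  all_goals first
    | decide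
    | (have h1 := S.natCard_classSet_eq_one_iff_level_mem.mpr (by decide); omega)
    | (have h3 := S.natCard_classSet_level_thirteen_two; omega)
    | (have h3 := S.natCard_classSet_level_nineteen_two; omega)
    | (have h3 := S.natCard_classSet_twentyThree; omega)
    | (have h3 := S.three_le_natCard_classSet_sixtySix; omega)

/-- **For Eichler packages** (`BrandtModule.lean`'s language, `N⁻` squarefree): class number two iff the level is one of the
nineteen. [cite: KirschmerVoight2010, §8 (Table 8.2)] -/
theorem _root_.Literature.NumberTheory.Automorphic.EichlerPackage.classNumber_eq_two_iff_level_mem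
    (P : EichlerPackage Nplus Nminus) (hsq : Squarefree Nminus) :
    P.brandtData.classNumber = 2 ↔
      (Nplus, Nminus) ∈ ({(7, 2), (15, 2), (17, 2), (23, 2), (5, 3), (7, 3), (8, 3), (11, 3), (3, 5), (4, 5), (2, 7),
        (3, 7), (1, 11), (1, 17), (1, 19), (1, 30), (1, 42), (1, 70), (1, 78)} : Finset (ℕ × ℕ)) := by
  have hO : IsZOrder P.O := P.isEichlerOrder.isZOrder
  have hri := rightIdeals_eq_invertibleRightIdeals_of_isTotallyDefinite P.isTotallyDefinite hO
  have key : P.brandtData.classNumber = Nat.card (ClassSet (P.toXiSetup hsq).O) := by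
    have h1 : Nat.card P.brandtData.ι = P.brandtData.classNumber := by
      rw [Nat.card_eq_fintype_card]
      rfl
    rw [← h1]
    change Nat.card P.brandtData.ι = Nat.card (ClassSet P.O)
    rw [Nat.card_congr (ClassSet.equivRightIdealClass hri)]
    rfl
  rw [key]
  exact (P.toXiSetup hsq).natCard_classSet_eq_two_iff_level_mem

/-- **The definite Eichler orders over `ℚ` of class number at most two**: `# Cls O ≤ 2` iff `(N⁺, N⁻)` is one of the
`12 + 19 = 31` levels. [cite: KirschmerVoight2010, §8 (Tables 8.1–8.2)] -/
theorem XiSetup.natCard_classSet_le_two_iff_level_mem (S : XiSetup Nplus Nminus) :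
    Nat.card (ClassSet S.O) ≤ 2 ↔
      (Nplus, Nminus) ∈ ({(1, 2), (3, 2), (5, 2), (9, 2), (11, 2), (1, 3), (2, 3), (4, 3), (1, 5), (2, 5), (1, 7), (1, 13),
        (7, 2), (15, 2), (17, 2), (23, 2), (5, 3), (7, 3), (8, 3), (11, 3), (3, 5), (4, 5), (2, 7), (3, 7), (1, 11), (1, 17),
        (1, 19), (1, 30), (1, 42), (1, 70), (1, 78)} : Finset (ℕ × ℕ)) := by
  haveI : Nonempty (ClassSet S.O) := S.nonempty_classSet
  have hpos : 0 < Nat.card (ClassSet S.O) := Nat.card_pos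
  have key : Nat.card (ClassSet S.O) ≤ 2 ↔ Nat.card (ClassSet S.O) = 1 ∨ Nat.card (ClassSet S.O) = 2 := by omega
  rw [key, S.natCard_classSet_eq_one_iff_level_mem, S.natCard_classSet_eq_two_iff_level_mem, ← Finset.mem_union]
  rw [show (({(1, 2), (3, 2), (5, 2), (9, 2), (11, 2), (1, 3), (2, 3), (4, 3), (1, 5), (2, 5), (1, 7),
        (1, 13)} : Finset (ℕ × ℕ)) ∪
      {(7, 2), (15, 2), (17, 2), (23, 2), (5, 3), (7, 3), (8, 3), (11, 3), (3, 5), (4, 5), (2, 7),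
        (3, 7), (1, 11), (1, 17), (1, 19), (1, 30), (1, 42), (1, 70), (1, 78)}) =
      ({(1, 2), (3, 2), (5, 2), (9, 2), (11, 2), (1, 3), (2, 3), (4, 3), (1, 5), (2, 5), (1, 7), (1, 13),
        (7, 2), (15, 2), (17, 2), (23, 2), (5, 3), (7, 3), (8, 3), (11, 3), (3, 5), (4, 5), (2, 7), (3, 7), (1, 11), (1, 17),
        (1, 19), (1, 30), (1, 42), (1, 70), (1, 78)} : Finset (ℕ × ℕ)) by decide]

end Brandt

end Literature.NumberTheory.Automorphic

end
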